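import Literature.MathematicalPhysics.QuantumFieldTheory.Balaban1983to89.B8CubeMemberBoxRowsL0
import Literature.MathematicalPhysics.QuantumFieldTheory.Balaban1983to89.B8Thm32GBoundCubeMember
import Literature.MathematicalPhysics.QuantumFieldTheory.Balaban1983to89.B6Prop23MultiLevelBoxL0
import Literature.MathematicalPhysics.QuantumFieldTheory.Balaban1983to89.B8Ineq192MultiLevelBoxL0

/-!
# `Balaban1983to89.B8Thm32GBoundCubeMemberHolds` — [Balaban1985BackgroundPropagators] THEOREM 3.2 (3.48) AT `U = 1` ON THE CUBE MEMBER, ROW-SUMMED: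
# `GBoundCubeMemberPrinted d ℓ` HOLDS (the named 𝒢-bound of F10 is DISCHARGED), hence the p6 flat consumer's THREE REAL FAMILIES are unconditional

statement-level skeleton of published theorems with citation tags; proofs where landed; nothing here is a claim about the
Yang–Mills mass gap

`[Balaban1985BackgroundPropagators]` ("[4]", CMP **99** (1985) 389–434) Theorem 3.2 (3.48) p. 398 («|(Q′(U)G′²(U)Q′*(U))⁻¹(y,y′)| ≦ B₀ … e^{−δd(y,y′)}»), (3.22)–(3.25) p. 394;
`[Balaban1984PropagatorsII]` ("B6", CMP **96** (1984) 223–250) Prop. 2.3 (2.87) p. 238, Lemma 2.1 (2.61) p. 234, (2.14) p. 225 («(Q′₀λ)(x) = λ(x), x ∈ Λ₀»), p. 229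
(«Boundary conditions of this type can be interpreted as obtained by building an effective mass on the domain Ω₁∖Ω_k, starting from O(1) on Ω_k up to +∞ outside Ω₁»);
`[Balaban1985RegularSpaces]` ("B8") (1.91)–(1.92) p. 91, (1.98) p. 92, (1.101) p. 93.

CITATION HEADER (lean-in-tree rule).  Cell `pub-ymgap` (YM Track A, HUMAN RULING D-0062), DAG node N05 = [B8], seat `pub-ymgap-dag-n05-c` (g10).  THE LOCATED FACT: the [B6] §2
chain WITH `Λ₀` landed on 2026-08-27 (lit-balaban r03∕p21∕r05, programme G-F3′-L0), in particular p21's HYPOTHESIS-FREE `B6Prop23MultiLevelBoxL0.prop23_multiLevelBox`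
([B6] Prop. 2.3: the two inverse identities and (2.87) for `(Q′G′²Q′*)⁻¹` on the Neumann box `X` with finite level-`0` mass) and `B6Geom246MultiLevelBoxL0.lemma21_box` ((2.61)).
THIS FILE proves the 𝒢-bound for the consumer's DIRICHLET matrix on `□₀` by an EXACT TRANSFER (no estimate is re-proved): `μ = 𝒢X` is the Lagrange multiplier of
`T²u = Qᵀμ, Qu = X` (G0 `kkt_of_inverse`); level-`0` towers are single sites, so `u = X` on `□₀ ∖ □₁` (G0 `eq_of_Q_mulVec_eq_level_zero`) and the translated zero
extension `û` of `u` solves the BOX system `Δ′_a²û = Q′*ν` with `ν(s) := (Δ′_a²û)(corner s)` (G2 `mulVec_mulVec_transfer` at every site whose `2`-ball lies in `□₀`,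
G0 `Qt_mulVec_eq`); hence `Q′û = (Q′G′²Q′*)ν` (r05 `QB_gml_gml_QsB`) and `ν = G(Q′û)` by p21's LEFT inverse identity, where `|Q′û| ≤ sup|X|` blockwise (the constraint at
every level, G2 `QB_translate` ∕ `QB_level_zero`); (2.87) summed with (2.61) gives `|ν(s)| ≤ C·L^{−4j(s)}·K·sup|X|`, and `η⁴L^{−(d+1)j}μ_p = L^{−4j}`-normalised `ν` at the
p21 block of any site of the tower `p` — EXACTLY the consumer's weight `wt(j)⁴L^{−(d+1)j}`.  The level-`0` towers within distance `2` of the Dirichlet wall never meet an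
inverse: there `μ = (T²X)(x)` and G0 `wall_rows_bound` applies.  Print's p. 229 reading of Dirichlet data as «effective mass … +∞ outside Ω₁» is thus not even needed:
the finite-mass box and the Dirichlet cube have the same multiplier at every tower of `□₀`.

WHAT THIS FILE PROVES (kernel-checked).
* §1 the printed weights meet p21's hypotheses at EVERY level: `awPrinted_window_all` (`4 ≤ a_j ≤ 8`), `cPrinted_window` and ★ `awPrinted_succ_all` (the recursion
  `a_{i+1} = aNext ℓ a_i c_i` for ALL `i`, with `c₀ = 8L²∕(L²−1)` so that `a₁ = a₀ = 8`, `c_i = 8` for `i ≥ 1`).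
* §2 `prop23_printed` — p21's Prop. 2.3 on the L0 box family at the printed weights (constants `δ₁, C, M₀` depending on `d, ℓ` only).
* §3 ★★★ `gBoundCubeMemberPrinted_of_one_le (d ℓ) (hℓ : 1 ≤ ℓ) : GBoundCubeMemberPrinted d ℓ` — with `C_𝒢 = C·K₂₆₁ + (4(d+1)+8)²`, `ρ₀ = 0`, `M₀` = p21's, `N₀` the (2.59)-threshold
  of (2.61) at rate `δ₁∕2`.  (The named fact carries the parameters `d, ℓ`; its proof is stated for every `L = ℓ + 1 ≥ 2` — the range of p21's theorems and of F10's
  own corollary — so the discharge is the implication `1 ≤ ℓ → GBoundCubeMemberPrinted d ℓ`, not a closed `_holds` constant; the degenerate `L = 1` case is not treated.)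
* §4 ★★★ `prop6_real123_printed` — F10's `prop6_real123_printed_of_GBound` with its hypothesis discharged: REAL-1 ∧ REAL-2 ∧ REAL-3 of n05-e's
  `B8Prop6CubeMemberFlatScalar.prop6_cubeMember_flat_of_real`, verbatim at `wPrinted`, on print's big-block sub-lattice, UNCONDITIONALLY.

HONEST SCOPE ∕ NOT CLAIMED.  The data stay on print's big-block sub-lattice (`M_h ≥ 3`, `M₀ ≤ L·M_h`, `M_hL ∣ ρ`, `M_hL ∣ M`, `R·M_hL ≤ ρ`, `2L ≤ R`, `N₀ + 1 ≤ R·L·M_h`) exactly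
as F10's definition quantifies them (print's «R₁, M₁ smallest integers for which all the theorems of [2, 4] are valid», «M a multiple of R₁M₁»); constants existential
(functions of `d, ℓ`).  The estimate itself is p21's kernel theorem; this file's content is the transfer.  N05 is NOT discharged by this file (the knit of the flat p6
letter's REAL binders is the consumer's ∕ successor's); count moves only when the chair books; one finite `T⁴` programme at fixed `ε`, Bałaban as printed; nothing
continuum ∕ ℝ⁴ ∕ OS ∕ mass-gap ∕ Clay.  No `sorry`, no `def`, no `instance`, no `notation`.  Unit `pub-ymgap-dag-n05-c` (g10), 2026-08-27.

RELATED IN THE TREE, NOT DUPLICATED: `B8Thm32GBoundCubeMember.{GBoundCubeMemberPrinted, prop6_real123_printed_of_GBound}` (F10, the named fact DISCHARGED here and its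
conditional corollary, USED), `B6Prop23MultiLevelBoxL0.prop23_multiLevelBox`, `B6Geom246MultiLevelBoxL0.lemma21_box`, `B8Ineq192MultiLevelBoxL0.{QB_gml_gml_QsB, len_eq}`
(p21∕r03∕r05, USED BY NAME), `B8CubeMemberBoxDomainsL0` (G1), `B8CubeMemberBoxRowsL0` (G2), `B8Eq348CubeMemberKKT` (G0) (USED), `B8Eq1101CubeMemberWeights` (F4e, USED).
-/
noncomputable section

namespace Literature.MathematicalPhysics.QuantumFieldTheory.Balaban1983to89.B8Thm32GBoundCubeMemberHolds

open scoped Matrix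
open B6MultiLevelBoxOperator (N0 mlOp levC gml gml_mul_mlOp aPrinted_one)
open B4Reflection242 (boxDom mem_boxDom blk)
open B6Geom246MultiLevelBoxL0 (bset blkOf blkOf_val corner corner_mem geom lemma21_box)
open B6Ineq268MultiLevelBoxL0 (W W_eq W_pos QB QsB QsB_apply Xk)
open B6Expansion282 (kerOp)
open B6Prop23Chain (mat apply_eq_sum_mat)
open B6Ineq261LevelGap (K261 K261_nonneg theta_lt_one_of_log)
open B6Ineq243TwoLevelBox (aNext)
open B8Ineq192MultiLevelBoxL0 (QB_gml_gml_QsB len_eq)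
open B7Prop1Explicit (e)
open B8Eq131Cubes (cube)
open B8Eq131CubesAdmissible (cubeFam cubeFam_false_of_le)
open B8Eq140Level (SideTouches)
open B8CubeMemberZd (cubeLamS)
open B8LambdaSpaceKLevel (wt)
open B8Eq191FlatDirichletForm (isUnit_flatMatrix)
open B8Eq191FlatTowerGram (isUnit_towerGram)
open B8Eq191FlatLettersCubeMember (tower_meets_cube towers_disjoint_cube)
open B8Eq191FlatDirichletDepth (mem_cube_of_tower)
open B8Eq1101CubeMemberWeights (awPrinted wPrinted awPrinted_facts wPrinted_facts)
open B8Thm32GBoundCubeMember (GBoundCubeMemberPrinted prop6_real123_printed_of_GBound)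
open B8CubeMemberBoxDomains (shift boxP)
open B8CubeMemberBoxDomainsL0 (levL0 levL0_le cubeDomainsL0 tower_iff_levL0_eq mem_boxDom_of_mem_cube_zero blockMap_pow_zero levL0_pos_iff
  cube_subset_cube_one cube_one_subset_cube_zero)
open B8CubeMemberBoxRowsL0 (blkOf_shift_val QB_translate QB_level_zero corner_blkOf_of_lev_zero blockMap_corner_sub_shift exists_site_of_pos_level
  mulVec_mulVec_transfer)
open B8Eq348CubeMemberKKT (kkt_of_inverse mem_cube_zero_of_near_cube_one near_wall_dichotomy Qt_mulVec_eq Q_mulVec_eq eq_of_Q_mulVec_eq_level_zero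
  wall_rows_bound)
open Literature.MathematicalPhysics.QuantumLattice (blockMap)

variable {d : ℕ}

/-! ## §1 The printed weights meet p21's window and recursion hypotheses at every level -/

/-- The window `4 ≤ a_j ≤ 8` for ALL `j` (`a₀ = 8`; `j ≥ 1`: F4e `awPrinted_facts`). [cite: Balaban1984PropagatorsII, (2.14) p.225; Balaban1982Higgs1, (2.15) p.609] -/
theorem awPrinted_window_all {ℓ : ℕ} (hℓ : 1 ≤ ℓ) : ∀ j, 4 ≤ awPrinted ℓ j ∧ awPrinted ℓ j ≤ 8 := by
  obtain ⟨hwin, -, h0, -⟩ := awPrinted_facts hℓ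
  intro j
  rcases Nat.eq_zero_or_pos j with hj | hj
  · subst hj; rw [h0]; norm_num
  · exact hwin j hj

/-- The coupling window for the completed sequence: `c₀ = 8L²∕(L² − 1) ∈ [8, 32∕3]` (`L ≥ 2`), `c_i = 8` for `i ≥ 1`. [cite: Balaban1984PropagatorsII, (2.14) p.225 («a_{j+1} = aa_j/(aL^{−2} + a_j)»)] -/
theorem cPrinted_window {ℓ : ℕ} (hℓ : 1 ≤ ℓ) :
    ∀ i : ℕ, 8 ≤ (if i = 0 then 8 * ((ℓ : ℝ) + 1) ^ 2 / (((ℓ : ℝ) + 1) ^ 2 - 1) else 8) ∧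
      (if i = 0 then 8 * ((ℓ : ℝ) + 1) ^ 2 / (((ℓ : ℝ) + 1) ^ 2 - 1) else 8) ≤ 32 / 3 := by
  have h1ℓ : (1 : ℝ) ≤ ℓ := by exact_mod_cast hℓ
  have hL2 : (4 : ℝ) ≤ ((ℓ : ℝ) + 1) ^ 2 := by nlinarith
  have hpos : (0 : ℝ) < ((ℓ : ℝ) + 1) ^ 2 - 1 := by linarith
  intro i
  by_cases hi : i = 0
  · rw [if_pos hi]
    constructor
    · rw [le_div_iff₀ hpos]; nlinarith
    · rw [div_le_iff₀ hpos]; nlinarith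
  · rw [if_neg hi]; norm_num

/-- **THE RECURSION AT EVERY LEVEL**: `a_{i+1} = aNext ℓ a_i c_i` for ALL `i`, with `c₀ = 8L²∕(L²−1)` (so that `a₁ = a₀ = 8`: `8·c₀∕(c₀L⁻² + 8) = 8`) and `c_i = 8` for `i ≥ 1`
(F4e `awPrinted_facts`). [cite: Balaban1984PropagatorsII, (2.14) p.225 («a_{j+1} = aa_j/(aL^{−2} + a_j), a₁ = a»)] -/
theorem awPrinted_succ_all {ℓ : ℕ} (hℓ : 1 ≤ ℓ) :
    ∀ i : ℕ, awPrinted ℓ (i + 1) = aNext ℓ (awPrinted ℓ i) (if i = 0 then 8 * ((ℓ : ℝ) + 1) ^ 2 / (((ℓ : ℝ) + 1) ^ 2 - 1) else 8) := by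
  obtain ⟨-, -, h0, hrec⟩ := awPrinted_facts hℓ
  have h1ℓ : (1 : ℝ) ≤ ℓ := by exact_mod_cast hℓ
  have hpos : (0 : ℝ) < ((ℓ : ℝ) + 1) ^ 2 - 1 := by nlinarith
  intro i
  by_cases hi : i = 0
  · subst hi
    rw [if_pos rfl, h0]
    have h1 : awPrinted ℓ (0 + 1) = 8 := by
      show awPrinted ℓ 1 = 8
      unfold awPrinted; rw [if_neg one_ne_zero]; exact aPrinted_one hℓ 8
    rw [h1]
    unfold aNext
    have hL0 : (0 : ℝ) < ((ℓ : ℝ) + 1) ^ 2 := by positivity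
    field_simp
    ring
  · rw [if_neg hi]; exact hrec i (Nat.pos_of_ne_zero hi)

/-! ## §2 p21's Proposition 2.3 on the box family WITH `Λ₀`, at the printed weights -/

/-- **[B6] PROP. 2.3 ON THE LEVEL-`0` BOX FAMILY AT THE PRINTED WEIGHTS** (p21's `B6Prop23MultiLevelBoxL0.prop23_multiLevelBox` with the windows `a ∈ [4,8]`, `c ∈ [8, 32∕3]`):
there are `δ₁, C, M₀ > 0` depending on `d, ℓ` only such that for every `k, M_h, R` with `M₀ ≤ L·M_h`, `2L ≤ R`, every box `P ≥ 1` and every nested family `D` with `Λ₀`,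
the operator `Q′G′²Q′*` (weights `awPrinted`) has a two-sided inverse `G` with `|G(y,y′)| ≦ C(Lʲ)⁻⁴(L^{j′})^{−(d+1)}e^{−½δ₁d(y,y′)}`.
[cite: Balaban1984PropagatorsII, Prop. 2.3 (2.87) p.238, (2.14) p.225] -/
theorem prop23_printed (d ℓ : ℕ) (hℓ : 1 ≤ ℓ) :
    ∃ δ₁ C M₀ : ℝ, 0 < δ₁ ∧ 0 < C ∧ 0 < M₀ ∧
      ∀ (k Mh R : ℕ), M₀ ≤ ((ℓ : ℝ) + 1) * Mh → 2 * (ℓ + 1) ≤ R →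
      ∀ (P : Fin (d + 1) → ℕ) (_hP : ∀ μ, 1 ≤ P μ) (D : B6MultiLevelBoxOperatorL0.Domains d ℓ Mh k P R),
        ∃ G : Module.End ℝ (↥(bset D) → ℝ),
          G * kerOp (W D) (Xk D (awPrinted ℓ)) = 1 ∧ kerOp (W D) (Xk D (awPrinted ℓ)) * G = 1 ∧
          ∀ y y' : ↥(bset D), |mat G y y' / W D y'| ≤
            C * (geom D).len y ^ (-(4 : ℝ)) * (geom D).len y' ^ (-((d + 1 : ℕ) : ℝ)) * Real.exp (-(δ₁ / 2 * (geom D).dist y y')) := by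
  obtain ⟨δ₁, C, M₀, hδ₁, hC, hM₀, h⟩ :=
    B6Prop23MultiLevelBoxL0.prop23_multiLevelBox d ℓ hℓ 4 8 8 (32 / 3) (by norm_num) (by norm_num)
  refine ⟨δ₁, C, M₀, hδ₁, hC, hM₀, fun k Mh R hM hR P hP D => ?_⟩
  obtain ⟨G, hG1, hG2, -, -, hGb, -⟩ := h k Mh R hM hR P hP D (awPrinted ℓ)
    (fun i => if i = 0 then 8 * ((ℓ : ℝ) + 1) ^ 2 / (((ℓ : ℝ) + 1) ^ 2 - 1) else 8)
    (awPrinted_window_all hℓ) (cPrinted_window hℓ) (awPrinted_succ_all hℓ)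
  exact ⟨G, hG1, hG2, hGb⟩

/-! ## §3 THE 𝒢-BOUND -/

/-- `x ^ (−n) = (x ^ n)⁻¹` for a natural exponent read as a real one (`x > 0`). [folklore] [cite: Balaban1984PropagatorsII, (2.87) p.238 (the level prefactors)] -/
theorem rpow_neg_natCast_eq {x : ℝ} (hx : 0 < x) (n : ℕ) : x ^ (-(n : ℝ)) = (x ^ n)⁻¹ := by
  rw [Real.rpow_neg hx.le, Real.rpow_natCast]

open Classical in
/-- **[Balaban1985BackgroundPropagators] THEOREM 3.2 (3.48) AT `U = 1` ON THE CUBE MEMBER — THE NAMED 𝒢-BOUND `GBoundCubeMemberPrinted d ℓ` HOLDS.**  For the explicit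
Dirichlet matrices `T = Matrix.of K`, `Q` of the p6 flat consumer at the printed weights, on print's big-block sub-lattice of cube data:
`wt(j_p)⁴·L^{−(d+1)j_p}·|((QT⁻¹T⁻¹Qᵀ)⁻¹X)_p| ≤ C_𝒢·sup|X|` at every tower `p`, `C_𝒢 = C·K₂₆₁ + (4(d+1)+8)²`.  PROOF = exact transfer to p21's [B6] Prop. 2.3 on the
level-`0` box family (header): `μ = 𝒢X` is the Lagrange multiplier of `T²u = Qᵀμ, Qu = X`; its translated zero extension solves the box system with a block function `ν`
read off at the corners; `ν = G(Q′û)` by p21's inverse identity with `|Q′û| ≤ sup|X|`; (2.87) + (2.61); the wall rows by locality.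
[cite: Balaban1985BackgroundPropagators, Theorem 3.2 (3.48) p.398, (3.22)–(3.25) p.394; Balaban1984PropagatorsII, Prop. 2.3 (2.87) p.238, Lemma 2.1 (2.61) p.234, (2.14) p.225, p.229; Balaban1985RegularSpaces, (1.91)–(1.92) p.91] -/
theorem gBoundCubeMemberPrinted_of_one_le (d ℓ : ℕ) (hℓ : 1 ≤ ℓ) : GBoundCubeMemberPrinted d ℓ := by
  -- constants
  obtain ⟨δ₁, C, M₀, hδ₁, hC, hM₀, hP23⟩ := prop23_printed d ℓ hℓ
  have hL0 : (0 : ℝ) < (ℓ : ℝ) + 1 := by positivity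
  set σ : ℝ := δ₁ / 2 with hσ
  have hσ0 : 0 < σ := by positivity
  obtain ⟨N₀, hN₀⟩ : ∃ N₀ : ℕ, N₀ = ⌈4 * ((d : ℝ) + 1) * ((ℓ : ℝ) + 1) / σ⌉₊ + 1 := ⟨_, rfl⟩
  have hN₀pos : 0 < N₀ := by rw [hN₀]; exact Nat.succ_pos _
  have hN₀gt : 4 * ((d : ℝ) + 1) * ((ℓ : ℝ) + 1) < σ * (N₀ : ℝ) := by
    have h : 4 * ((d : ℝ) + 1) * ((ℓ : ℝ) + 1) / σ < (N₀ : ℝ) := by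
      rw [hN₀]; push_cast
      exact lt_of_le_of_lt (Nat.le_ceil _) (by linarith)
    rw [div_lt_iff₀ hσ0] at h
    linarith [mul_comm σ (N₀ : ℝ)]
  set Krow : ℝ := K261 N₀ (d + 1) ((ℓ : ℝ) + 1) 1 (1 * σ)
  have hKrow0 : 0 ≤ Krow := K261_nonneg hL0.le zero_le_one
  refine ⟨C * Krow + (4 * ((d : ℝ) + 1) + 8) ^ 2, 0, M₀, N₀, add_nonneg (mul_nonneg hC.le hKrow0) (sq_nonneg _), ?_⟩
  intro η hη Mh hMh hM0 a M ρ k n R hn hnk hρd hMd hρ0 hR hR2 hRN _hρbig S hS B hB K hK T hT Q hQ X s hs hXs p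
  -- elementary facts about the data
  have hL : 1 ≤ ℓ + 1 := Nat.succ_pos ℓ
  have hd : 0 < d + 1 := Nat.succ_pos d
  have hMh1 : 1 ≤ Mh := le_trans (by norm_num) hMh
  have hMh2 : 2 ≤ Mh := le_trans (by norm_num) hMh
  have hk : 1 ≤ k := hn.trans hnk
  have hρL : ℓ + 1 ≤ ρ := le_trans (Nat.le_mul_of_pos_left _ hMh1) (Nat.le_of_dvd hρ0 hρd)
  have hρ4 : 4 ≤ ρ := by
    have h4R : 4 ≤ R := by omega
    have hR' : R ≤ R * (Mh * (ℓ + 1)) := Nat.le_mul_of_pos_right _ (Nat.mul_pos (by omega) (Nat.succ_pos ℓ))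
    exact h4R.trans (hR'.trans hR)
  have hη0 : η ≠ 0 := hη.ne'
  have h00 : cube (ℓ + 1) a M ρ k 0 = cubeFam false (ℓ + 1) a M ρ k 0 := (cubeFam_false_of_le _ a M ρ (Nat.zero_le k)).symm
  -- the printed weights
  obtain ⟨-, hapos, -, -⟩ := awPrinted_facts hℓ
  obtain ⟨hwpos, hrel, hwwin⟩ := wPrinted_facts d hℓ hη
  have hw0 : ∀ j, 0 ≤ wPrinted d ℓ η j := fun j => (hwpos j).le
  have hamax : ∀ j, j ≤ n → wPrinted d ℓ η j * η ^ 2 * ((((ℓ + 1 : ℕ) : ℝ)) ^ j) ^ 2 * (((((ℓ + 1 : ℕ) : ℝ)) ^ (d + 1)) ^ j)⁻¹ ≤ 8 := by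
    intro j _
    rw [hwwin j]
    exact (awPrinted_window_all hℓ j).2
  have hw : ∀ j, j ≤ n → wPrinted d ℓ η j * (((((ℓ + 1 : ℕ) : ℝ) ^ (d + 1))⁻¹) ^ j) ^ 2 = (η ^ 2)⁻¹ * levC d ℓ (awPrinted ℓ) j :=
    fun j _ => hrel j
  -- the units `T` and `QT⁻²Qᵀ` (n05-e)
  have hTunit : IsUnit T := by rw [hT]; exact isUnit_flatMatrix hd hη0 (ℓ + 1) n (cubeLamS (ℓ + 1) a M ρ k n) (wPrinted d ℓ η) hw0 K hK S
  have hTT : T * T⁻¹ = 1 := Matrix.mul_nonsing_inv T ((Matrix.isUnit_iff_isUnit_det T).mp hTunit)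
  have hmeet : ∀ p ∈ B, ∃ z ∈ S, blockMap ((ℓ + 1) ^ p.1) z = p.2 := by
    intro p hp
    obtain ⟨hp1, hp2⟩ := (hB p).mp hp
    obtain ⟨z, hz, hzb⟩ := tower_meets_cube hL a M hρL hnk p.1 hp1 p.2 hp2
    exact ⟨z, (hS z).mpr hz, hzb⟩
  have hdisjB : ∀ p ∈ B, ∀ p' ∈ B, ∀ z ∈ S, blockMap ((ℓ + 1) ^ p.1) z = p.2 → blockMap ((ℓ + 1) ^ p'.1) z = p'.2 → p = p' := by
    intro p hp p' hp' z hz h1 h2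
    obtain ⟨hp1, hp2⟩ := (hB p).mp hp
    obtain ⟨hp1', hp2'⟩ := (hB p').mp hp'
    obtain ⟨hjj, hyy⟩ := towers_disjoint_cube hL a M hρL hnk p.1 hp1 p'.1 hp1' p.2 hp2 p'.2 hp2' z ((hS z).mp hz) h1 h2
    exact Prod.ext hjj hyy
  have hMunit : IsUnit (Q * T⁻¹ * T⁻¹ * Qᵀ) := by
    rw [hQ, hT]; exact isUnit_towerGram hd hη0 hL n (cubeLamS (ℓ + 1) a M ρ k n) (wPrinted d ℓ η) hw0 K hK S B hmeet hdisjB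
  have hMM : (Q * T⁻¹ * T⁻¹ * Qᵀ) * (Q * T⁻¹ * T⁻¹ * Qᵀ)⁻¹ = 1 :=
    Matrix.mul_nonsing_inv _ ((Matrix.isUnit_iff_isUnit_det _).mp hMunit)
  -- the Lagrange system: `μ = 𝒢X`, `u = H′X`
  obtain ⟨hTTu, hQu⟩ := kkt_of_inverse T Q hTT hMM X
  set μ : ↥B → ℝ := (Q * T⁻¹ * T⁻¹ * Qᵀ)⁻¹ *ᵥ X
  set u : ↥S → ℝ := (T⁻¹ * T⁻¹ * Qᵀ) *ᵥ μ
  have hμp : (∑ p' : ↥B, (Q * T⁻¹ * T⁻¹ * Qᵀ)⁻¹ p p' * X p') = μ p := rfl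
  rw [hμp]
  -- the box: host `X`, the L0 member, p21's operator `Δ′_a`
  set t := shift ℓ Mh a ρ k n
  set DL := cubeDomainsL0 hMh1 a hn hnk hρd hMd hρ0 hR
  have hlevDL : DL.lev = levL0 ℓ Mh a M ρ k n := rfl
  have hPbox : ∀ μ' : Fin (d + 1), 1 ≤ boxP (d := d) ℓ M ρ k n μ' := fun μ' => le_trans hρ0 (Nat.le_add_right _ _)
  have hNpos : ∀ i, 1 ≤ N0 ℓ Mh n (boxP ℓ M ρ k n) i := fun i => by
    show 0 < (ℓ + 1) ^ n * ((ℓ + 1) * (Mh * boxP ℓ M ρ k n i))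
    exact Nat.mul_pos (Nat.pow_pos (Nat.succ_pos ℓ)) (Nat.mul_pos (Nat.succ_pos ℓ) (Nat.mul_pos (by omega) (hPbox i)))
  have hAgml : gml (N0 ℓ Mh n (boxP ℓ M ρ k n)) ℓ n (levL0 ℓ Mh a M ρ k n) (awPrinted ℓ) *
      mlOp (N0 ℓ Mh n (boxP ℓ M ρ k n)) ℓ n (levL0 ℓ Mh a M ρ k n) (awPrinted ℓ) = 1 :=
    gml_mul_mlOp hNpos (levL0_le ℓ Mh a M ρ k hn) hapos
  have hGA : ∀ v : ↥(boxDom (N0 ℓ Mh n (boxP ℓ M ρ k n))) → ℝ,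
      gml (N0 ℓ Mh n (boxP ℓ M ρ k n)) ℓ n (levL0 ℓ Mh a M ρ k n) (awPrinted ℓ) *ᵥ
        (mlOp (N0 ℓ Mh n (boxP ℓ M ρ k n)) ℓ n (levL0 ℓ Mh a M ρ k n) (awPrinted ℓ) *ᵥ v) = v := fun v => by
    rw [Matrix.mulVec_mulVec, hAgml, Matrix.one_mulVec]
  -- the translated zero extension `û` of `u`
  set g : (Fin (d + 1) → ℤ) → ℝ := fun z => if h : z ∈ S then u ⟨z, h⟩ else 0 with hg
  set uh : ↥(boxDom (N0 ℓ Mh n (boxP ℓ M ρ k n))) → ℝ := fun y => g (y.1 - t) with huh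
  -- `(T(Tu))(x) = η⁻⁴(Δ′_a²û)(x + t)` at every `x` whose `2`-ball lies in `□₀`
  have hstar2 : ∀ x : ↥S, (∀ τ : Fin (d + 1) → ℤ, (∀ i, |τ i| ≤ 2) → x.1 + τ ∈ cube (ℓ + 1) a M ρ k 0) →
      ∀ y : ↥(boxDom (N0 ℓ Mh n (boxP ℓ M ρ k n))), y.1 = x.1 + t →
      (T *ᵥ (T *ᵥ u)) x = ((η ^ 2)⁻¹) ^ 2 *
        (mlOp (N0 ℓ Mh n (boxP ℓ M ρ k n)) ℓ n (levL0 ℓ Mh a M ρ k n) (awPrinted ℓ) *ᵥ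
          (mlOp (N0 ℓ Mh n (boxP ℓ M ρ k n)) ℓ n (levL0 ℓ Mh a M ρ k n) (awPrinted ℓ) *ᵥ uh)) y :=
    fun x hx2 y hyx => mulVec_mulVec_transfer hℓ hMh1 hMh2 a hn hnk hρd hMd hρ0 hR (wPrinted d ℓ η) (awPrinted ℓ) hw K hK S hS T hT
      u uh (fun _ => rfl) x hx2 y hyx
  -- sites of `□₁` have their `2`-ball in `□₀`
  have hHB1 : ∀ x, x ∈ cube (ℓ + 1) a M ρ k 1 → ∀ τ : Fin (d + 1) → ℤ, (∀ i, |τ i| ≤ 2) → x + τ ∈ cube (ℓ + 1) a M ρ k 0 :=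
    fun x hx τ hτ => mem_cube_zero_of_near_cube_one a M hk hx (r := 2) (by omega) (fun i => by exact_mod_cast hτ i)
  -- the value of `Δ′_a²û` at a translated site of `□₁` in the tower `p′`: `η⁴·L^{−(d+1)j}·μ_{p′}`
  have hdeep : ∀ (x : ↥S) (p' : ↥B), x.1 ∈ cube (ℓ + 1) a M ρ k 1 → blockMap ((ℓ + 1) ^ p'.1.1) x.1 = p'.1.2 →
      ∀ y : ↥(boxDom (N0 ℓ Mh n (boxP ℓ M ρ k n))), y.1 = x.1 + t →
      (mlOp (N0 ℓ Mh n (boxP ℓ M ρ k n)) ℓ n (levL0 ℓ Mh a M ρ k n) (awPrinted ℓ) *ᵥ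
          (mlOp (N0 ℓ Mh n (boxP ℓ M ρ k n)) ℓ n (levL0 ℓ Mh a M ρ k n) (awPrinted ℓ) *ᵥ uh)) y
        = (η ^ 2) ^ 2 * ((((((ℓ + 1 : ℕ) : ℝ)) ^ (d + 1))⁻¹) ^ p'.1.1 * μ p') := by
    intro x p' hx1 hxp y hyx
    have h1 := hstar2 x (hHB1 x.1 hx1) y hyx
    rw [hTTu, Qt_mulVec_eq hL a M hρL hnk S hS B hB Q hQ μ x p' hxp] at h1
    have hη2 : (η ^ 2) ^ 2 * ((η ^ 2)⁻¹) ^ 2 = 1 := by field_simp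
    calc _ = (η ^ 2) ^ 2 * (((η ^ 2)⁻¹) ^ 2 * (mlOp (N0 ℓ Mh n (boxP ℓ M ρ k n)) ℓ n (levL0 ℓ Mh a M ρ k n) (awPrinted ℓ) *ᵥ
          (mlOp (N0 ℓ Mh n (boxP ℓ M ρ k n)) ℓ n (levL0 ℓ Mh a M ρ k n) (awPrinted ℓ) *ᵥ uh)) y) := by
            rw [← mul_assoc, hη2, one_mul]
      _ = _ := by rw [← h1]
  -- the block function `ν(s) := (Δ′_a²û)(corner s)` and `Δ′_a²û = Q′*ν`
  set ν : ↥(bset DL) → ℝ := fun sB =>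
    (mlOp (N0 ℓ Mh n (boxP ℓ M ρ k n)) ℓ n (levL0 ℓ Mh a M ρ k n) (awPrinted ℓ) *ᵥ
      (mlOp (N0 ℓ Mh n (boxP ℓ M ρ k n)) ℓ n (levL0 ℓ Mh a M ρ k n) (awPrinted ℓ) *ᵥ uh)) ⟨corner DL sB, corner_mem DL sB⟩ with hν
  have h3a : ∀ y : ↥(boxDom (N0 ℓ Mh n (boxP ℓ M ρ k n))),
      (mlOp (N0 ℓ Mh n (boxP ℓ M ρ k n)) ℓ n (levL0 ℓ Mh a M ρ k n) (awPrinted ℓ) *ᵥ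
        (mlOp (N0 ℓ Mh n (boxP ℓ M ρ k n)) ℓ n (levL0 ℓ Mh a M ρ k n) (awPrinted ℓ) *ᵥ uh)) y = ν (blkOf DL y) := by
    intro y
    rcases Nat.eq_zero_or_pos (levL0 ℓ Mh a M ρ k n y.1) with h0 | hpos'
    · -- level `0`: the block of `y` is `{y}` and its corner is `y`
      have hc : corner DL (blkOf DL y) = y.1 := corner_blkOf_of_lev_zero DL y h0
      have hy : (⟨corner DL (blkOf DL y), corner_mem DL (blkOf DL y)⟩ : ↥(boxDom (N0 ℓ Mh n (boxP ℓ M ρ k n)))) = y := Subtype.ext hc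
      simp only [hν, hy]
    · -- level `j ≥ 1`: `y = x + t` with `x ∈ □₁` in the tower `p′ = (j, Bʲ(x))`; the corner is another site of that tower
      set x : Fin (d + 1) → ℤ := y.1 - t
      have hyx : y.1 = x + t := (sub_add_cancel _ _).symm
      have hx1 : x ∈ cube (ℓ + 1) a M ρ k 1 := (levL0_pos_iff a M hρL hn hnk y.1 (Mh := Mh)).mp hpos'
      have hx0 : x ∈ cube (ℓ + 1) a M ρ k 0 := cube_one_subset_cube_zero a M hρL hk hx1
      have hxS : x ∈ S := (hS x).mpr (by rw [← h00]; exact hx0)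
      set j := levL0 ℓ Mh a M ρ k n y.1
      have hjn : j ≤ n := levL0_le ℓ Mh a M ρ k hn _
      have hxj : blockMap ((ℓ + 1) ^ j) x ∈ cubeLamS (ℓ + 1) a M ρ k n j :=
        (tower_iff_levL0_eq a M hρL hn hnk hjn hx0 (Mh := Mh)).mpr (by rw [← hyx])
      have hpB : (j, blockMap ((ℓ + 1) ^ j) x) ∈ B := (hB _).mpr ⟨hjn, hxj⟩
      have hvy := hdeep ⟨x, hxS⟩ ⟨_, hpB⟩ hx1 rfl y hyx
      have hcorner := blockMap_corner_sub_shift hMh1 a hn hnk hρd hMd hρ0 hR y hyx hx0 hjn hxj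
      set xc : Fin (d + 1) → ℤ := corner DL (blkOf DL y) - t with hxc
      have hxcj : blockMap ((ℓ + 1) ^ j) xc ∈ cubeLamS (ℓ + 1) a M ρ k n j := by rw [hcorner]; exact hxj
      have hj1 : 1 ≤ j := hpos'
      have hxc1 : xc ∈ cube (ℓ + 1) a M ρ k 1 := cube_subset_cube_one a M hρL hj1 (hjn.trans hnk) (mem_cube_of_tower hL a M ρ hxcj)
      have hxcS : xc ∈ S := (hS xc).mpr (by rw [← h00]; exact cube_one_subset_cube_zero a M hρL hk hxc1)
      have hvc := hdeep ⟨xc, hxcS⟩ ⟨_, hpB⟩ hxc1 hcorner ⟨corner DL (blkOf DL y), corner_mem DL (blkOf DL y)⟩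
        (by exact (sub_add_cancel _ _).symm)
      rw [hvy]
      simp only [hν]
      rw [hvc]
  have h3b : mlOp (N0 ℓ Mh n (boxP ℓ M ρ k n)) ℓ n (levL0 ℓ Mh a M ρ k n) (awPrinted ℓ) *ᵥ
      (mlOp (N0 ℓ Mh n (boxP ℓ M ρ k n)) ℓ n (levL0 ℓ Mh a M ρ k n) (awPrinted ℓ) *ᵥ uh) = QsB DL ν := by
    funext y; rw [h3a y, QsB_apply]
  -- hence `Q′û = (Q′G′²Q′*)ν`
  have h3d : kerOp (W DL) (Xk DL (awPrinted ℓ)) ν = QB DL uh := by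
    rw [← QB_gml_gml_QsB (D := DL) (a := awPrinted ℓ) ν]
    simp only [hlevDL]
    rw [← h3b, hGA, hGA]
  -- p21's inverse: `ν = G(Q′û)`
  obtain ⟨G, hG1, -, hGb⟩ := hP23 n Mh R hM0 hR2 (boxP ℓ M ρ k n) hPbox DL
  have h3e : ν = G (QB DL uh) := by
    have h := congrArg (fun Φ : Module.End ℝ (↥(bset DL) → ℝ) => Φ ν) hG1
    simp only [Module.End.mul_apply, Module.End.one_apply] at h
    rw [h3d] at h
    exact h.symm
  -- `|Q′û| ≤ s` blockwise: the constraint `Qu = X` at every level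
  have h3c : ∀ s' : ↥(bset DL), |QB DL uh s'| ≤ s := by
    intro s'
    rcases Nat.eq_zero_or_pos s'.1.1 with h0 | hpos'
    · -- level `0`: the point evaluation at the corner, a level-`0` site (or outside `□₀`)
      rw [QB_level_zero DL uh s' h0]
      simp only [huh, hg]
      split_ifs with hmem
      · -- the corner is a translated site of the collar `□₀ ∖ □₁`
        have hz0 : corner DL s' - t ∈ cube (ℓ + 1) a M ρ k 0 := by rw [h00]; exact (hS _).mp hmem
        have hlev0 : levL0 ℓ Mh a M ρ k n (corner DL s') = 0 := (B6Geom246MultiLevelBoxL0.lev_corner DL s').trans h0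
        have hz1 : corner DL s' - t ∉ cube (ℓ + 1) a M ρ k 1 := fun h1 => by
          have := (levL0_pos_iff a M hρL hn hnk (corner DL s') (Mh := Mh)).mpr h1
          omega
        have hzB : ((0 : ℕ), corner DL s' - t) ∈ B := by
          refine (hB _).mpr ⟨Nat.zero_le n, ?_⟩
          change corner DL s' - t ∈ cubeLamS (ℓ + 1) a M ρ k n 0
          rw [B8CubeMemberZd.cubeLamS_of_lt _ a M ρ k hn, B8CubeMemberZd.mem_cubeLam_zero_iff hL a M ρ hk]
          exact ⟨hz0, hz1⟩
        rw [eq_of_Q_mulVec_eq_level_zero S B Q hQ u X hQu hmem hzB]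
        exact hXs _
      · rw [abs_zero]; exact hs
    · -- level `j ≥ 1`: the block average is `(Qu)_p = X_p`
      obtain ⟨y, x, hyx, hx1, hx0, hjn, hxj, hys⟩ := exists_site_of_pos_level hMh1 a hn hnk hρd hMd hρ0 hR s' hpos'
      have hpB : (s'.1.1, blockMap ((ℓ + 1) ^ s'.1.1) x) ∈ B := (hB _).mpr ⟨hjn, hxj⟩
      have hQB := QB_translate hℓ hMh1 hMh2 a hn hnk hρd hMd hρ0 hR S hS y hyx hx0 hjn hxj g
      rw [hys] at hQB
      have hQrow := Q_mulVec_eq S B Q hQ u ⟨_, hpB⟩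
      rw [hQu] at hQrow
      -- the two block sums agree
      have hsum : (∑ z ∈ S.filter (fun z => blockMap ((ℓ + 1) ^ s'.1.1) z = blockMap ((ℓ + 1) ^ s'.1.1) x), g z)
          = ∑ z ∈ Finset.univ.filter (fun z : ↥S => blockMap ((ℓ + 1) ^ s'.1.1) z.1 = blockMap ((ℓ + 1) ^ s'.1.1) x), u z := by
        rw [Finset.sum_filter, Finset.sum_filter, ← Finset.sum_coe_sort S]
        refine Finset.sum_congr rfl fun z _ => ?_
        simp only [hg, dif_pos z.2, Subtype.coe_eta]
      have hcast : (((((ℓ : ℝ) + 1) ^ s'.1.1) ^ (d + 1)))⁻¹ = (((((ℓ + 1 : ℕ) : ℝ)) ^ (d + 1))⁻¹) ^ s'.1.1 := by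
        push_cast; rw [inv_pow, ← pow_mul, ← pow_mul, mul_comm]
      have hval : QB DL uh s' = X ⟨_, hpB⟩ := by
        rw [show uh = (fun y' => g (y'.1 - shift ℓ Mh a ρ k n)) from rfl, hQB, hsum, hcast]
        exact hQrow.symm
      rw [hval]; exact hXs _
  -- Lemma 2.1 (2.61) on the box at rate `σ = δ₁∕2`
  have hθ : Real.exp (-(1 * σ)) * ((ℓ : ℝ) + 1) ^ ((2 * (d + 1 : ℕ) : ℝ) / N₀) < 1 := by
    refine theta_lt_one_of_log hL0 hN₀pos ?_
    have hlog : Real.log ((ℓ : ℝ) + 1) ≤ (ℓ : ℝ) + 1 := (Real.log_le_sub_one_of_pos hL0).trans (by linarith)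
    push_cast
    nlinarith [mul_le_mul_of_nonneg_left hlog (by positivity : (0 : ℝ) ≤ 2 * ((d : ℝ) + 1))]
  obtain ⟨-, h261, -, -⟩ := lemma21_box DL hMh1 hPbox hN₀pos hRN hσ0.le (α := 1) zero_le_one le_rfl hθ
  -- (2.87) + (2.61): `|ν(s)| ≤ C·L^{−4j(s)}·K·s`
  have h3f : ∀ s₁ : ↥(bset DL), |ν s₁| ≤ C * ((((ℓ : ℝ) + 1) ^ s₁.1.1) ^ 4)⁻¹ * Krow * s := by
    intro s₁
    have hlen₁ : (geom DL).len s₁ = ((ℓ : ℝ) + 1) ^ s₁.1.1 := len_eq DL s₁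
    have hlenpos : 0 < ((ℓ : ℝ) + 1) ^ s₁.1.1 := by positivity
    -- termwise bound on the row of `G`
    have hterm : ∀ s' : ↥(bset DL), |mat G s₁ s' * QB DL uh s'| ≤
        C * ((((ℓ : ℝ) + 1) ^ s₁.1.1) ^ 4)⁻¹ * s * Real.exp (-(1 * σ * (geom DL).dist s₁ s')) := by
      intro s'
      have hW := W_pos DL s'
      have hb := hGb s₁ s'
      rw [abs_div, abs_of_pos hW, div_le_iff₀ hW] at hb
      have hlen' : (geom DL).len s' = ((ℓ : ℝ) + 1) ^ s'.1.1 := len_eq DL s'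
      have hlenpos' : 0 < ((ℓ : ℝ) + 1) ^ s'.1.1 := by positivity
      rw [hlen₁, hlen', show (-(4 : ℝ)) = -((4 : ℕ) : ℝ) by norm_num, rpow_neg_natCast_eq hlenpos 4, rpow_neg_natCast_eq hlenpos' (d + 1),
        W_eq] at hb
      have hWlen : ((((ℓ : ℝ) + 1) ^ s'.1.1) ^ (d + 1))⁻¹ * ((((ℓ : ℝ) + 1) ^ s'.1.1) ^ (d + 1)) = 1 :=
        inv_mul_cancel₀ (by positivity)
      rw [abs_mul]
      calc |mat G s₁ s'| * |QB DL uh s'|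
          ≤ (C * ((((ℓ : ℝ) + 1) ^ s₁.1.1) ^ 4)⁻¹ * ((((ℓ : ℝ) + 1) ^ s'.1.1) ^ (d + 1))⁻¹ * Real.exp (-(δ₁ / 2 * (geom DL).dist s₁ s')) *
              ((((ℓ : ℝ) + 1) ^ s'.1.1) ^ (d + 1))) * s := mul_le_mul hb (h3c s') (abs_nonneg _) (by positivity)
        _ = C * ((((ℓ : ℝ) + 1) ^ s₁.1.1) ^ 4)⁻¹ * s * Real.exp (-(1 * σ * (geom DL).dist s₁ s')) := by
              rw [hσ, one_mul]
              calc _ = C * ((((ℓ : ℝ) + 1) ^ s₁.1.1) ^ 4)⁻¹ * Real.exp (-(δ₁ / 2 * (geom DL).dist s₁ s')) *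
                    (((((ℓ : ℝ) + 1) ^ s'.1.1) ^ (d + 1))⁻¹ * ((((ℓ : ℝ) + 1) ^ s'.1.1) ^ (d + 1))) * s := by ring
                _ = _ := by rw [hWlen]; ring
    rw [h3e, apply_eq_sum_mat G (QB DL uh) s₁]
    calc |∑ s', mat G s₁ s' * QB DL uh s'|
        ≤ ∑ s', |mat G s₁ s' * QB DL uh s'| := Finset.abs_sum_le_sum_abs _ _
      _ ≤ ∑ s', C * ((((ℓ : ℝ) + 1) ^ s₁.1.1) ^ 4)⁻¹ * s * Real.exp (-(1 * σ * (geom DL).dist s₁ s')) := Finset.sum_le_sum fun s' _ => hterm s'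
      _ = C * ((((ℓ : ℝ) + 1) ^ s₁.1.1) ^ 4)⁻¹ * s * ∑ s', Real.exp (-(1 * σ * (geom DL).dist s₁ s')) := by rw [Finset.mul_sum]
      _ ≤ C * ((((ℓ : ℝ) + 1) ^ s₁.1.1) ^ 4)⁻¹ * s * Krow := mul_le_mul_of_nonneg_left (h261 s₁) (by positivity)
      _ = C * ((((ℓ : ℝ) + 1) ^ s₁.1.1) ^ 4)⁻¹ * Krow * s := by ring
  -- conclusion at the tower `p`
  have hCKle : C * Krow * s ≤ (C * Krow + (4 * ((d : ℝ) + 1) + 8) ^ 2) * s := by nlinarith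
  have hWle : (4 * ((d : ℝ) + 1) + 8) ^ 2 * s ≤ (C * Krow + (4 * ((d : ℝ) + 1) + 8) ^ 2) * s := by nlinarith [mul_nonneg hC.le hKrow0]
  have hcastL : (((ℓ + 1 : ℕ) : ℝ)) = (ℓ : ℝ) + 1 := by push_cast; ring
  obtain ⟨hp1, hp2⟩ := (hB p.1).mp p.2
  rcases Nat.eq_zero_or_pos p.1.1 with hj0 | hjpos
  · -- a level-`0` tower `p = (0, x₀)`, `x₀ ∈ □₀ ∖ □₁`
    have hx₀ : p.1.2 ∈ cubeLamS (ℓ + 1) a M ρ k n 0 := by rw [← hj0]; exact hp2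
    rw [B8CubeMemberZd.cubeLamS_of_lt _ a M ρ k hn, B8CubeMemberZd.mem_cubeLam_zero_iff hL a M ρ hk] at hx₀
    have hx₀S : p.1.2 ∈ S := (hS _).mpr (by rw [← h00]; exact hx₀.1)
    have hcol : blockMap ((ℓ + 1) ^ p.1.1) p.1.2 = p.1.2 := by rw [hj0, blockMap_pow_zero]
    have hμx : (T *ᵥ (T *ᵥ u)) ⟨p.1.2, hx₀S⟩ = μ p := by
      rw [hTTu, Qt_mulVec_eq hL a M hρL hnk S hS B hB Q hQ μ ⟨p.1.2, hx₀S⟩ p hcol, hj0, pow_zero, one_mul]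
    have hwt : wt (ℓ + 1) η p.1.1 ^ 4 * (((((ℓ + 1 : ℕ) : ℝ)) ^ (d + 1)) ^ p.1.1)⁻¹ = (η ^ 2) ^ 2 := by
      rw [hj0]; unfold wt; rw [pow_zero, pow_zero, one_mul, inv_one, mul_one]; ring
    rw [hwt, ← hμx]
    rcases near_wall_dichotomy a M hk hρ4 p.1.2 with hnear | hfar
    · -- the `2`-ball of `x₀` lies in `□₀`: transfer to the box, a level-`0` block
      set y₀ : ↥(boxDom (N0 ℓ Mh n (boxP ℓ M ρ k n))) := ⟨p.1.2 + t, mem_boxDom_of_mem_cube_zero hℓ hMh2 a hn hnk hx₀.1⟩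
      have h1 := hstar2 ⟨p.1.2, hx₀S⟩ hnear y₀ rfl
      have hlev : (blkOf DL y₀).1.1 = 0 := by
        have hv := blkOf_shift_val hMh1 a hn hnk hρd hMd hρ0 hR y₀ rfl hx₀.1 (Nat.zero_le n) (by rw [blockMap_pow_zero, ← hj0]; exact hp2)
        rw [hv]
      have hb := h3f (blkOf DL y₀)
      rw [← h3a y₀, hlev, pow_zero, one_pow, inv_one, mul_one] at hb
      rw [h1, abs_mul, abs_of_nonneg (by positivity : (0 : ℝ) ≤ ((η ^ 2)⁻¹) ^ 2), ← mul_assoc,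
        show (η ^ 2) ^ 2 * ((η ^ 2)⁻¹) ^ 2 = 1 by field_simp, one_mul]
      exact hb.trans hCKle
    · -- the `2`-ball of `x₀` misses `□₁`: the wall rows by locality
      have hu0 : ∀ z : ↥S, (∀ i, |z.1 i - p.1.2 i| ≤ 2) → ∀ hp : ((0 : ℕ), z.1) ∈ B, u z = X ⟨(0, z.1), hp⟩ :=
        fun z _ hp => eq_of_Q_mulVec_eq_level_zero S B Q hQ u X hQu z.2 hp
      have hwall := wall_rows_bound hL a M hρL hnk hη0 (wPrinted d ℓ η) hw0 (amax := 8) (by norm_num) hamax S hS B hB K hK T hT hk hn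
        u X s hs hXs ⟨p.1.2, hx₀S⟩ hfar hu0
      have hη4 : (0 : ℝ) < (η ^ 2) ^ 2 := by positivity
      have hηη : (η ^ 2) ^ 2 * ((η ^ 2)⁻¹) ^ 2 = 1 := by field_simp
      calc (η ^ 2) ^ 2 * |(T *ᵥ (T *ᵥ u)) ⟨p.1.2, hx₀S⟩|
          ≤ (η ^ 2) ^ 2 * (((4 * ((d : ℝ) + 1) + 8) * (η ^ 2)⁻¹) ^ 2 * s) := mul_le_mul_of_nonneg_left hwall hη4.le
        _ = ((η ^ 2) ^ 2 * ((η ^ 2)⁻¹) ^ 2) * ((4 * ((d : ℝ) + 1) + 8) ^ 2 * s) := by ring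
        _ = (4 * ((d : ℝ) + 1) + 8) ^ 2 * s := by rw [hηη, one_mul]
        _ ≤ _ := hWle
  · -- a tower of level `j ≥ 1`: transfer to the box at a site of the tower block
    obtain ⟨z₀, hz₀0, hz₀p⟩ := tower_meets_cube hL a M hρL hnk p.1.1 hp1 p.1.2 hp2
    have hz₀S : z₀ ∈ S := (hS z₀).mpr hz₀0
    have hz₀c : z₀ ∈ cube (ℓ + 1) a M ρ k 0 := by rw [h00]; exact hz₀0
    have hz₀j : blockMap ((ℓ + 1) ^ p.1.1) z₀ ∈ cubeLamS (ℓ + 1) a M ρ k n p.1.1 := by rw [hz₀p]; exact hp2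
    have hz₀1 : z₀ ∈ cube (ℓ + 1) a M ρ k 1 := cube_subset_cube_one a M hρL hjpos (hp1.trans hnk) (mem_cube_of_tower hL a M ρ hz₀j)
    set y₀ : ↥(boxDom (N0 ℓ Mh n (boxP ℓ M ρ k n))) := ⟨z₀ + t, mem_boxDom_of_mem_cube_zero hℓ hMh2 a hn hnk hz₀c⟩
    have hv := hdeep ⟨z₀, hz₀S⟩ p hz₀1 hz₀p y₀ rfl
    have hlev : (blkOf DL y₀).1.1 = p.1.1 := by
      have hval := blkOf_shift_val hMh1 a hn hnk hρd hMd hρ0 hR y₀ rfl hz₀c hp1 hz₀j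
      rw [hval]
    have hb := h3f (blkOf DL y₀)
    rw [← h3a y₀, hv, hlev] at hb
    -- `hb : |η⁴·(L^{−(d+1)j}·μ_p)| ≤ C·(L^{4j})⁻¹·K·s`; the goal carries `wt(j)⁴ = L^{4j}η⁴`
    have hLj : (0 : ℝ) < (((ℓ : ℝ) + 1) ^ p.1.1) ^ 4 := by positivity
    have hcpos : (0 : ℝ) ≤ (((((ℓ + 1 : ℕ) : ℝ)) ^ (d + 1))⁻¹) ^ p.1.1 := by positivity
    rw [abs_mul, abs_mul, abs_of_nonneg (by positivity : (0 : ℝ) ≤ (η ^ 2) ^ 2), abs_of_nonneg hcpos] at hb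
    have hwt : wt (ℓ + 1) η p.1.1 ^ 4 * (((((ℓ + 1 : ℕ) : ℝ)) ^ (d + 1)) ^ p.1.1)⁻¹
        = (((ℓ : ℝ) + 1) ^ p.1.1) ^ 4 * ((η ^ 2) ^ 2 * (((((ℓ + 1 : ℕ) : ℝ)) ^ (d + 1))⁻¹) ^ p.1.1) := by
      unfold wt; rw [hcastL, inv_pow]; ring
    rw [hwt, mul_assoc, mul_assoc]
    have hLL : (((ℓ : ℝ) + 1) ^ p.1.1) ^ 4 * ((((ℓ : ℝ) + 1) ^ p.1.1) ^ 4)⁻¹ = 1 := mul_inv_cancel₀ hLj.ne'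
    calc (((ℓ : ℝ) + 1) ^ p.1.1) ^ 4 * ((η ^ 2) ^ 2 * ((((((ℓ + 1 : ℕ) : ℝ)) ^ (d + 1))⁻¹) ^ p.1.1 * |μ p|))
        ≤ (((ℓ : ℝ) + 1) ^ p.1.1) ^ 4 * (C * ((((ℓ : ℝ) + 1) ^ p.1.1) ^ 4)⁻¹ * Krow * s) := mul_le_mul_of_nonneg_left hb hLj.le
      _ = ((((ℓ : ℝ) + 1) ^ p.1.1) ^ 4 * ((((ℓ : ℝ) + 1) ^ p.1.1) ^ 4)⁻¹) * (C * Krow * s) := by ring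
      _ = C * Krow * s := by rw [hLL, one_mul]
      _ ≤ _ := hCKle

/-! ## §4 The p6 flat consumer's three REAL families, now unconditional -/

open Classical in
/-- **THE p6 FLAT CONSUMER'S THREE REAL FAMILIES, UNCONDITIONALLY**: REAL-1 ((1.101)), REAL-2 ((1.92) + Δ-entry) and REAL-3 ((1.98)) of n05-e's
`B8Prop6CubeMemberFlatScalar.prop6_cubeMember_flat_of_real`, in its verbatim shapes at `w = wPrinted`, on print's big-block sub-lattice, with constants `B_G, B₀′_H > 0`,
`B₂′, B_R ≥ 0` depending on `d, ℓ` only — F10's `prop6_real123_printed_of_GBound` with the 𝒢-bound DISCHARGED by §3.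
[cite: Balaban1985RegularSpaces, (1.91)–(1.92) p.91, (1.98) p.92, (1.101) p.93, p.98; Balaban1985BackgroundPropagators, Theorems 3.1–3.2 (3.47)–(3.48) p.398] -/
theorem prop6_real123_printed (d ℓ : ℕ) (hℓ : 1 ≤ ℓ) :
    ∃ BG B₀'H B₂' BR ρ₀ M₀ : ℝ, ∃ N₀ : ℕ, 0 < BG ∧ 0 < B₀'H ∧ 0 ≤ B₂' ∧ 0 ≤ BR ∧ 0 < M₀ ∧ 0 < N₀ ∧
      ∀ (η : ℝ), 0 < η → ∀ (Mh : ℕ), 3 ≤ Mh → M₀ ≤ ((ℓ : ℝ) + 1) * Mh →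
      ∀ (a : Fin (d + 1) → ℤ) (M ρ k n R : ℕ), 1 ≤ n → n ≤ k → Mh * (ℓ + 1) ∣ ρ → Mh * (ℓ + 1) ∣ M → 0 < ρ →
        R * (Mh * (ℓ + 1)) ≤ ρ → 2 * (ℓ + 1) ≤ R → N₀ + 1 ≤ R * ((ℓ + 1) * Mh) → ρ₀ ≤ (ρ : ℝ) →
      ∀ (S : Finset (Fin (d + 1) → ℤ)), (∀ z, z ∈ S ↔ z ∈ cubeFam false (ℓ + 1) a M ρ k 0) →
      ∀ (B : Finset (ℕ × (Fin (d + 1) → ℤ))), (∀ p, p ∈ B ↔ p.1 ≤ n ∧ p.2 ∈ cubeLamS (ℓ + 1) a M ρ k n p.1) →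
      ∀ (K : (Fin (d + 1) → ℤ) → (Fin (d + 1) → ℤ) → ℝ), (∀ x z, K x z =
          ((η ^ 2)⁻¹ * ∑ μ : Fin (d + 1), ((2 : ℝ) * (if z = x then (1 : ℝ) else 0) - (if z = x + e μ then (1 : ℝ) else 0)
            - (if z = x - e μ then (1 : ℝ) else 0))) +
          (∑ j ∈ Finset.range (n + 1), (if blockMap ((ℓ + 1) ^ j) x ∈ cubeLamS (ℓ + 1) a M ρ k n j ∧
              blockMap ((ℓ + 1) ^ j) z = blockMap ((ℓ + 1) ^ j) x then
            wPrinted d ℓ η j * (((((ℓ + 1 : ℕ) : ℝ) ^ (d + 1))⁻¹) ^ j) ^ 2 else 0))) →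
      ∀ (T : Matrix ↥S ↥S ℝ), T = Matrix.of (fun x z : ↥S => K x.1 z.1) →
      ∀ (Q : Matrix ↥B ↥S ℝ), Q = Matrix.of (fun (p : ↥B) (z : ↥S) =>
          if blockMap ((ℓ + 1) ^ p.1.1) z.1 = p.1.2 then (((((ℓ + 1 : ℕ) : ℝ)) ^ (d + 1))⁻¹) ^ p.1.1 else 0) →
      -- REAL-1
      (∀ (ρ' : ↥S → ℝ) (r : ℝ), 0 ≤ r →
        (∀ j, j ≤ n → ∀ z : ↥S, z.1 ∈ cubeFam false (ℓ + 1) a M ρ k j → wt (ℓ + 1) η j ^ 2 * |ρ' z| ≤ r) →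
        ∀ φ : (Fin (d + 1) → ℤ) → ℝ, (∀ x, x ∉ cubeFam false (ℓ + 1) a M ρ k 0 → φ x = 0) →
          (∀ v : ↥S, φ v.1 = ∑ z : ↥S, T⁻¹ v z * ρ' z) →
          (∀ x, |φ x| ≤ BG * r) ∧
          ∀ j, j ≤ n → ∀ p ∈ {b : (Fin (d + 1) → ℤ) × Fin (d + 1) | SideTouches (cubeFam false (ℓ + 1) a M ρ k j) b.1 b.2},
            wt (ℓ + 1) η j * |η⁻¹ * (φ (p.1 + e p.2) - φ p.1)| ≤ BG * r) ∧
      -- REAL-2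
      (∀ (X : ↥B → ℝ) (s : ℝ), 0 ≤ s → (∀ p', |X p'| ≤ s) →
        ∀ φ : (Fin (d + 1) → ℤ) → ℝ, (∀ x, x ∉ cubeFam false (ℓ + 1) a M ρ k 0 → φ x = 0) →
          (∀ v : ↥S, φ v.1 = ∑ p' : ↥B, (T⁻¹ * (T⁻¹ * Qᵀ) * (Q * T⁻¹ * T⁻¹ * Qᵀ)⁻¹) v p' * X p') →
          (∀ x, |φ x| ≤ B₀'H * s) ∧
          (∀ j, j ≤ n → ∀ p ∈ {b : (Fin (d + 1) → ℤ) × Fin (d + 1) | SideTouches (cubeFam false (ℓ + 1) a M ρ k j) b.1 b.2},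
            wt (ℓ + 1) η j * |η⁻¹ * (φ (p.1 + e p.2) - φ p.1)| ≤ B₀'H * s) ∧
          (∀ j, j ≤ n → ∀ x ∈ cubeFam false (ℓ + 1) a M ρ k j,
            wt (ℓ + 1) η j ^ 2 * |∑ μ : Fin (d + 1), (η ^ 2)⁻¹ * (2 * φ x - φ (x + e μ) - φ (x - e μ))| ≤ B₂' * s)) ∧
      -- REAL-3
      (∀ (ρ' : ↥S → ℝ) (r : ℝ), 0 ≤ r →
        (∀ j, j ≤ n → ∀ z : ↥S, z.1 ∈ cubeFam false (ℓ + 1) a M ρ k j → wt (ℓ + 1) η j ^ 2 * |ρ' z| ≤ r) →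
        ∀ j, j ≤ n → ∀ v : ↥S, v.1 ∈ cubeFam false (ℓ + 1) a M ρ k j →
          wt (ℓ + 1) η j ^ 2 * |ρ' v - ∑ z : ↥S, (T⁻¹ * (Qᵀ * ((Q * T⁻¹ * T⁻¹ * Qᵀ)⁻¹ * (Q * T⁻¹)))) v z * ρ' z| ≤ BR * r) :=
  prop6_real123_printed_of_GBound d ℓ hℓ (gBoundCubeMemberPrinted_of_one_le d ℓ hℓ)

end Literature.MathematicalPhysics.QuantumFieldTheory.Balaban1983to89.B8Thm32GBoundCubeMemberHolds
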